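import Summits.ResolutionOfSingularities.ResolutionOfSingularities.Theorems.ChainW52TargetsF7BetaR
import Summits.ResolutionOfSingularities.ResolutionOfSingularities.Theorems.FrobeniusClosingPatchingRelPerfectDepthBetaTwoComposition
import Summits.ResolutionOfSingularities.ResolutionOfSingularities.Theorems.FrobeniusClosingPatchingRelPerfectTowerContraction
import Summits.ResolutionOfSingularities.ResolutionOfSingularities.Theorems.ValuativePatchingRelBlowupSequenceComposite
import Literature.AlgebraicGeometry.Resolution.ExcellentBlowup
import HarnessLib

/-!
# Crux `PatchingRelPerfect` (stmt-ResolutionOfSingularities-16161), chain W5.2 — F7(β) (β-AX) d = 2, T5: THE COMPOSITION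
# v6 twin `betaTwo_atomConclusion_of_targets : ChainW52F7BetaR.BetaTwoComposition₂` (targets of record `ChainW52TargetsF7BetaR`)

[OURS · L1 W5.2 · F7(β) (β-AX) · T5 · res-L1-w52-plan-1 RULINGs G11-29 (3)(b) / G11-46, hand res-D-repro-1 AS res-L1-repro-3] The (β) d = 2 atom
conclusion `BetaTwoAtomConclusion₂` from the four typed targets OF RECORD `ChainW52TargetsF7BetaR` (v6; the v5 twin over p552304 is
`…DepthBetaTwoComposition`, same proof): T0 `InitialMultiHost₂`, T2
`CJSTransport₂`, T2c `FormatEndOnCyl₂` and ONE pole atlas `P` with `StepStable P`, `AtlasInitial P`, `PhaseCTermination₂ P` (T3) —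
i.e. a PROOF of the v6 composition statement `ChainW52F7BetaR.BetaTwoComposition₂` (theorem `betaTwo_atomConclusion_of_targetsR`;
the zero-form lemma is REUSED from the v5 file p554474), fact-free (F-32bR enters only through the `CJSTransport₂` hypothesis,
supplied downstream as `transport_of_cjsB hlift hCJS`).  NOT a statement of the manuscript under review; AI-written, weaker than expert
review.  Mathlib + landed W5.2 files only; no definition, no fact, no sorry.

## The proof (pattern `atomConclusion_of_tower`, `…TowerContraction` l.114)
Zero forms are discarded (`exists_gradedMemberIdeal_eq_of_ne_zero`: the graded member ideal of a family is that of its non-zero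
sub-family).  T0 gives the initial cylinder state `(St, cyl)` on `X` over `Spec S` with the depth-two invariant (`I𝒪_X = M₀ · K`, `M₀`
effective Cartier, `St.K = K`, `g : X → Spec S` a blowing up cosupported in the closed point, `E`-points over the closed point) and
`cyl.V = ⊤`, so the atlas holds at generation 0 (`AtlasInitial`).  T2 transports one CJS run: `π : X₁ → X` a blowing up cosupported in
the carrier (hence over the closed point), `S₁.K = K𝒪_{X₁}`, `S₁.n = St.n ≠ 0`, `X₁` regular (and excellent, `IsBlowup.isExcellent`), the
atlas kept, one snc family presenting the traces.  T2c puts `S₁` in format-snc END on `cyl₁.V`.  T3 (Phase C) yields regular centres `s`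
over `cosupp S₁.K` with regular Noetherian top and the RESIDUAL FACTORISATION `S₁.K𝒪_{top} = M · S♭.K`, `M` effective Cartier, `S♭`
format-snc on `U′ ⊇ cosupp S♭.K` with `S♭.n ≠ 0`; E1 + T4 (`IsFormatSncOn.exists_centreSeq`, p546954/p543632) principalise `S♭.K` by
regular centres `s₂` over `cosupp S♭.K` with regular top.  All centres lie over the closed point (`cosupp K ⊆ V(𝓘_E²) = E`,
`cosupp S♭.K ⊆ cosupp (M · S♭.K)`), so `g`, `π`, `s`, `s₂` compose to ONE blowing up of `Spec S` cosupported in the closed point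
(`IsBlowup.exists_isBlowup_comp_supported`, `CentreSeq.exists_isBlowup_comp_of_centresOver` — Temkin 2.1.4 / Stacks 080B), on whose
regular top `I𝒪 = M₀𝒪 · M𝒪 · S♭.K𝒪` is locally principal (`IsLocallyPrincipal.comap/.mul`); `atomConclusion_of_tower` contracts the
tower to the registered conclusion for every `T = Bl_I Spec S`.

## References
* J. Kollár, *Lectures on Resolution of Singularities* (2007), (3.111) Step 3. [Kollar2007]
* M. Temkin, *Desingularization of quasi-excellent schemes in characteristic zero*, Adv. Math. 219 (2008), Lemma 2.1.4. [Temkin2008]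
* The Stacks Project, Tags 080A, 080B. [StacksProject]
-/

-- `Summit.<Summit>.<Sub>.Theorems` with `Sub = Summit` (single-conjunct summit, D-0017)
set_option linter.dupNamespace false

noncomputable section

open CategoryTheory CategoryTheory.Limits AlgebraicGeometry TopologicalSpace IsLocalRing
open Literature.AlgebraicGeometry.Resolution Scheme.IdealSheafData
open Literature.AlgebraicGeometry.Hironaka2017.MonomialPart Literature.AlgebraicGeometry.Motives

namespace Summit.ResolutionOfSingularities.ResolutionOfSingularities.Theorems

universe u

namespace ChainW52F7BetaR

open DepthMultiHost

section T5

open DepthTargets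

/-- [OURS · L1 W5.2 · F7(β) (β-AX) T5, TARGETS v6] **THE COMPOSITION `betaTwo_atomConclusion_of_targetsR : ChainW52F7BetaR.BetaTwoComposition₂`**
(res-L1-w52-plan-1 RULING G11-29 (3)(b) / G11-46; the v6 twin of `ChainW52F7Beta.betaTwo_atomConclusion_of_targets` p554474 — NOT a restatement: v6΄s
`StepStable` carries the lower bound and v6΄s `AtlasInitial` the generation-1 antecedents with `InitialShape`, so the two `BetaTwoComposition₂` are
different propositions; pattern `atomConclusion_of_tower`): T0 gives the initial cylinder state on `X = Bl_𝔪 Spec S` with the depth-two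
invariant `I𝒪_X = M₀ · K`; the pole atlas `P` holds there (`AtlasInitial`: `cyl.V = ⊤` and the generation-1 antecedents incl. `InitialShape`, all from T0΄s conclusion); T2 transports one CJS run (`π : X₁ → X`, a
blowing up cosupported in the carrier, `S₁.K = K𝒪_{X₁}`, `P` kept); T2c puts `S₁` in format-snc END on the cylinder open; T3 (Phase C)
gives regular centres over `cosupp S₁.K` with regular top and the RESIDUAL FACTORISATION `S₁.K𝒪 = M · S♭.K`, `M` effective Cartier, `S♭`
format-snc on `U′ ⊇ cosupp S♭.K`; E1 + T4 (`IsFormatSncOn.exists_centreSeq`) principalise `S♭.K` by regular centres over its cosupport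
with regular top; all four towers have centres over the closed point, so they compose to ONE blowing up of `Spec S` cosupported in the
closed point (`IsBlowup.exists_isBlowup_comp_supported`, `CentreSeq.exists_isBlowup_comp_of_centresOver`) on whose regular top
`I𝒪 = M₀𝒪 · M𝒪 · S♭.K𝒪` is locally principal; `atomConclusion_of_tower` contracts.  Zero forms are discarded first
(`ChainW52F7Beta.exists_gradedMemberIdeal_eq_of_ne_zero`, p554474).  Fact-free as a composition: F-32bR enters only through the `CJSTransport₂` hypothesis.
[cite: Kollar2007, (3.111) Step 3] [cite: StacksProject, Tag 080A] [cite: Temkin2008, Lemma 2.1.4] -/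
theorem betaTwo_atomConclusion_of_targetsR : ChainW52F7BetaR.BetaTwoComposition₂.{u} := by
  rintro hT0 hT2 hT2c ⟨Pa, hPa, hPa₀, hC⟩ S iS₁ iS₂ iS₃ hdim κ₀ iκ σ hσ x hx s Pf hPf hI T f hf
  classical
  -- discard the zero forms
  obtain ⟨s', e, hne, hIe⟩ := ChainW52F7Beta.exists_gradedMemberIdeal_eq_of_ne_zero σ x 2 2 Pf
  rw [← hIe] at hI hf
  -- T0: the initial cylinder state
  obtain ⟨X, g, i, K, instX, St, cyl, instZ₁, instZ₂, hinv, hXexc, hStK, hn0, h𝓔, hrange, hV, hZreg, hZexc, hZdim⟩ :=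
    hT0 S hdim κ₀ σ hσ x hx s' (Pf ∘ e) (fun k => hPf (e k)) hne
  haveI := hinv.isClosedImmersion
  -- the atlas holds at generation 0 (`AtlasInitial`: every antecedent is in T0΄s conclusion)
  have hshape : InitialShape St cyl := by
    refine ⟨S, iS₁, iS₂, iS₃, hdim, κ₀, iκ, σ, hσ, x, hx, s', Pf ∘ e, fun k => hPf (e k), hne, g, i, ?_, hrange⟩
    rw [hStK]
    exact hinv
  have hP0 : Pa St cyl := hPa₀ St cyl hV hZreg hZexc hZdim h𝓔 hXexc hn0 hshape
  -- T2: one CJS run, transported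
  obtain ⟨X₁, π, instX₁, S₁, cyl₁, ρ, instZ₃, instZ₄, 𝓔₁, hPS₁, ⟨Q, hπQ, hQsupp⟩, hX₁reg, hK₁, hn₁, -, hZ₁reg, hsnc₁, hnodup₁, -,
    hirr₁, hbd₁, htr₁⟩ := hT2 Pa hPa hinv.isRegular St cyl hZreg hZexc hZdim h𝓔 hP0
  -- T2c: format-snc END on the cylinder open
  obtain ⟨𝓒, 𝓗, hfmt⟩ := hT2c hX₁reg S₁ cyl₁ hZ₁reg 𝓔₁ hsnc₁ hnodup₁ hirr₁ hbd₁ htr₁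
  -- T3: Phase C in the residual currency
  obtain ⟨sq, -, hsover, hstop, instTop, M, Sf, hfac, hM, hSfn, U', 𝓒', 𝓗', hfmt', hU'⟩ :=
    hC hX₁reg (hπQ.isExcellent hXexc) S₁ cyl₁ hZ₁reg (hn₁ ▸ hn0 :) 𝓒 𝓗 hfmt hPS₁
  -- E1 + T4 on the residual state
  obtain ⟨s₂, -, hs₂over, htop₂, hlp₂⟩ := hfmt'.exists_centreSeq hstop hSfn hU'
  -- the format on `X` and the blow-up data of `g`
  obtain ⟨M₀, hM₀, hIMK⟩ := hinv.exists_format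
  obtain ⟨K₀, hgK₀, hK₀⟩ := hinv.exists_isBlowup_supported
  -- every centre lies over the closed point
  have hKsupp : (K.support : Set X) ⊆ g ⁻¹' {IsLocalRing.closedPoint S} := by
    intro y hy
    have hy' : y ∈ (i.ker.support : Set X) := by
      have h2 : K.support ≤ (i.ker ^ 2).support := support_antitone hinv.ker_pow_le
      rw [support_pow i.ker 2 two_ne_zero] at h2
      exact h2 hy
    rw [Scheme.Hom.support_ker, i.isClosedEmbedding.isClosed_range.closure_eq] at hy'
    obtain ⟨e', rfl⟩ := hy'
    exact hinv.map_eq_closedPoint e'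
  have hQsupp' : (Q.support : Set X) ⊆ g ⁻¹' {IsLocalRing.closedPoint S} := by
    intro y hy
    obtain ⟨z, rfl⟩ := hrange (hQsupp hy)
    exact hinv.map_eq_closedPoint z
  haveI : IsNoetherianRing (CommRingCat.of S) := inferInstanceAs (IsNoetherianRing S)
  obtain ⟨K₁, hK₁b, hK₁s⟩ := IsBlowup.exists_isBlowup_comp_supported g K₀ π Q _ hgK₀ hK₀ hπQ hQsupp'
  have hS₁supp : (S₁.K.support : Set X₁) ⊆ (π ≫ g) ⁻¹' {IsLocalRing.closedPoint S} := by
    intro y hy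
    rw [hK₁, hStK, support_comap] at hy
    exact hKsupp hy
  obtain ⟨Q₂, hQ₂b, hQ₂s⟩ :=
    CentreSeq.exists_isBlowup_comp_of_centresOver sq _ (CentreSeq.CentresOver.mono sq hS₁supp hsover)
  obtain ⟨K₂, hK₂b, hK₂s⟩ := IsBlowup.exists_isBlowup_comp_supported (π ≫ g) K₁ sq.comp Q₂ _ hK₁b hK₁s hQ₂b hQ₂s
  have hSfsupp : (Sf.K.support : Set sq.top) ⊆ (sq.comp ≫ π ≫ g) ⁻¹' {IsLocalRing.closedPoint S} := by
    intro y hy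
    have h1 : y ∈ ((S₁.K.comap sq.comp).support : Set sq.top) := by
      rw [hfac, support_mul, TopologicalSpace.Closeds.coe_sup]
      exact Or.inr hy
    rw [support_comap] at h1
    exact hS₁supp h1
  obtain ⟨Q₃, hQ₃b, hQ₃s⟩ :=
    CentreSeq.exists_isBlowup_comp_of_centresOver s₂ _ (CentreSeq.CentresOver.mono s₂ hSfsupp hs₂over)
  obtain ⟨K₃, hK₃b, hK₃s⟩ :=
    IsBlowup.exists_isBlowup_comp_supported (sq.comp ≫ π ≫ g) K₂ s₂.comp Q₃ _ hK₂b hK₂s hQ₃b hQ₃s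
  -- `I𝒪 = M₀𝒪 · M𝒪 · S♭.K𝒪` on the top is locally principal
  have hlp : IsLocallyPrincipal
      ((affineBlowup.idealSheaf (gradedMemberIdeal σ x 2 2 (Pf ∘ e))).comap (s₂.comp ≫ sq.comp ≫ π ≫ g)) := by
    rw [comap_comp, comap_comp, comap_comp, hIMK, comap_mul, ← hStK, ← hK₁, comap_mul, hfac, comap_mul, comap_mul]
    exact (((hM₀.isLocallyPrincipal.comap π).comap sq.comp).comap s₂.comp).mul
      ((hM.isLocallyPrincipal.comap s₂.comp).mul hlp₂)
  exact atomConclusion_of_tower hI hK₃b hK₃s htop₂ hlp T f hf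

end T5

end ChainW52F7BetaR

end Summit.ResolutionOfSingularities.ResolutionOfSingularities.Theorems

end
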